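import Summits.NavierStokesRegularity.NavierStokesRegularity.Theorems.PoloidalWindowDoorPoloidalWindowRigidityZShockRotatingProfile
import Summits.NavierStokesRegularity.NavierStokesRegularity.Theorems.PoloidalWindowDoorPoloidalWindowRigidityZShockObliqueProfilePlane
import HarnessLib

/-!
# Crux K2 `PoloidalWindowRigidity` (stmt-NavierStokesRegularity-19708), line `z_shock` — R3 inhabitant census: ROTATING PATTERNS of the
# autonomous thick height-evolution (II) — the conformal (log-polar) identity, the RADIUS-AS-TIME form of the profile equation, and the
# radial dichotomy

`--supports stmt-NavierStokesRegularity-19708 --as helper` (leafhand-ns-poloidalwindowdoor-3 g9, cell decomp-ns, 2026-08-31).  Class-free,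
def-free; tree files `…ZShockRotatingProfile` (part I: orbits, profile equation, angular flatness) and `…ZShockObliqueProfilePlane` (only for
the radial case).  **No stub and no summit is closed by this file; Navier–Stokes regularity is NOT proved here (rung 0).**

WHY THIS FILE.  Part I typed the rotating-pattern inhabitant candidates `W(s, y) = Ψ(R_{ωs} y)` of the autonomous thick column of
`stub_zShockThickAut` (census item «rotating patterns [L]», hands 3-g6/3-g7/3-g8) by their profile equation `ω² ΘΘΨ = Σᵢ ∂ᵢ(γ(Ψ) ∂ᵢΨ)`
(`ΘΨ(y) = DΨ(y)[Jy]`, `Jy = (−y₁, y₀)`).  The mechanism remark (b) of 3-g8 reads this equation in polar variables: outside the sonic circle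
`ω²|y|² = γ` the radius is TIME-like and the angle a periodic SPACE variable, so the exterior problem is a 1+1 genuinely nonlinear hyperbolic
problem with periodic data.  This file makes that reading a kernel identity WITHOUT a polar chart — the radial and angular derivatives are the
commuting vector fields `X = y·∇` (`XΨ(y) = DΨ(y)[y]`) and `Θ = Jy·∇`, i.e. `∂_ρ` and `∂_θ` of the conformal log-polar chart `ρ = log|y|`:

* ★ `normSq_mul_divForm_eq` — **the conformal identity** `|y|² Σᵢ ∂ᵢ(γ(Ψ)∂ᵢΨ) = X(γ(Ψ) XΨ) + Θ(γ(Ψ) ΘΨ)` for `C²` `Ψ`, `C¹` `γ` (pure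
  second-order calculus in the atoms `∂ᵢΨ, ∂ⱼ∂ᵢΨ, γ(Ψ), γ'(Ψ)`; the cross terms cancel, no symmetry of second derivatives is used);
* `angularDeriv_normSq_mul` — `Θ(|y|² ΘΨ) = |y|² ΘΘΨ` (the radius is constant along rotation orbits);
* ★ `rotating_profile_equation_logpolar` — **the profile equation in radius-as-time form** `X(γ(Ψ) XΨ) = Θ((ω²|y|² − γ(Ψ)) ΘΨ)`, i.e.
  `∂_ρ(γ(Ψ)Ψ_ρ) = ∂_θ((ω² e^{2ρ} − γ(Ψ)) Ψ_θ)`: the oblique-profile equation `∂₀(γ∂₀Ψ) = ∂₁((κ₀² − γ)∂₁Ψ)` of `…ZShockObliqueProfilePlane`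
  with the drift `κ₀² = ω²e^{2ρ}` now GROWING WITH THE TIME-LIKE VARIABLE — supersonic (hyperbolic, `ρ` as time) exactly outside the sonic
  circle, subsonic inside, NON-AUTONOMOUS in `ρ`; which is precisely why the tree's autonomous R2/R2½ theorems (`…ZShockScalarWaveLiouville`,
  `…ZShockObliqueProfile{,Plane}`) do not apply verbatim and the item is sized [L];
* ★ `rotating_radial_const` — **the radial dichotomy.**  If `ΘΨ ≡ 0` (the pattern does not turn) then the profile equation is
  `Σᵢ ∂ᵢ(γ(Ψ)∂ᵢΨ) = 0`, and a bounded `Ψ` with `0 < γlo ≤ γ ≤ γhi` is CONSTANT (`obliqueProfile_const_of_subsonic_plane` at drift `0`, i.e.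
  Moser's Liouville theorem `Literature.Analysis.PDE.DivForm.divFormLiouville_holds`, proved in the tree); so a non-constant rotating inhabitant
  turns somewhere, and by part I its turning rate `ΘΨ` is bounded by `2π sup|Σᵢ ∂ᵢ(γ∂ᵢΨ)|/ω²`.

What remains («rotating patterns [L]», unchanged in size but now typed): a bounded `C²` (in the class: analytic, all derivatives bounded)
solution of `∂_ρ(γ(Ψ)Ψ_ρ) = ∂_θ((ω²e^{2ρ} − γ(Ψ))Ψ_θ)` on the cylinder `ℝ_ρ × (ℝ/2πℤ)_θ`, `γ` thick with one-signed `γ'`, has `Ψ_θ ≡ 0`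
— a ONE-SIDED (forward in `ρ`), periodic-data, non-autonomous version of the tree's scalar R2; the tree's Riccati / loaded-characteristics /
periodic-recurrence files (`…ZShockCharacteristicRiccati`, `…ZShockLoadedCharacteristics`, `…ZShockPeriodicRecurrence`, `…ZShockRiccatiDivergent`)
are the 1-D engine.  presearch: as in part I (corpus hybrid + vsearch: bifurcation theory of rotating waves / reaction–diffusion spirals only;
galaxy substring «rotating wave|spiral characteristic|rigidly rotating», all stars: no relevant hit). [folklore]
-/

noncomputable section

namespace Summit.NavierStokesRegularity.NavierStokesRegularity.Theorems.PoloidalWindowDoorPoloidalWindowRigidityZShockRotatingProfileLogPolar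

-- the summit and its single sub-problem share the name (CONVENTIONS §1)
set_option linter.dupNamespace false

open Set Filter Topology Function
open Summit.NavierStokesRegularity.NavierStokesRegularity.Theorems.PoloidalWindowDoorPoloidalWindowRigidityZShockObliqueProfilePlane
open Summit.NavierStokesRegularity.NavierStokesRegularity.Theorems.PoloidalWindowDoorPoloidalWindowRigidityZShockRotatingProfile

variable {Ψ : EuclideanSpace ℝ (Fin 2) → ℝ} {γ : ℝ → ℝ} {ω : ℝ} {y : EuclideanSpace ℝ (Fin 2)}
  {c : ℝ → EuclideanSpace ℝ (Fin 2)} {J : EuclideanSpace ℝ (Fin 2) → EuclideanSpace ℝ (Fin 2)}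

/-! ### The conformal (log-polar) identity and the radius-as-time form -/

/-- ★ **The conformal (log-polar) identity.**  For `Ψ : ℝ² → ℝ` of class `C²` and `γ ∈ C¹`, at every point `x`,
`|x|² · Σᵢ ∂ᵢ(γ(Ψ) ∂ᵢΨ)(x) = X(γ(Ψ) XΨ)(x) + Θ(γ(Ψ) ΘΨ)(x)`, where `XΨ(x') = DΨ(x')[x']` is the radial (Euler) derivative and
`ΘΨ(x') = DΨ(x')[Jx']`, `Jx' = (−x'₁, x'₀)`, the angular one (`X = ∂_ρ`, `Θ = ∂_θ` in the log-polar chart `ρ = log|x|`, which is conformal).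
Proof: expand both sides in the atoms `∂ᵢΨ`, `∂ⱼ∂ᵢΨ`, `γ(Ψ)`, `γ'(Ψ)`; the cross terms cancel (no symmetry of second derivatives is needed).
[folklore] -/
theorem normSq_mul_divForm_eq (hΨ : ContDiff ℝ 2 Ψ) (hγ : ContDiff ℝ 1 γ)
    (hJ : ∀ y' : EuclideanSpace ℝ (Fin 2), J y' = (-(y' 1)) • EuclideanSpace.single (0 : Fin 2) (1 : ℝ) +
      (y' 0) • EuclideanSpace.single (1 : Fin 2) (1 : ℝ))
    (x : EuclideanSpace ℝ (Fin 2)) :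
    ‖x‖ ^ 2 * ∑ i, fderiv ℝ (fun x' => γ (Ψ x') * fderiv ℝ Ψ x' (EuclideanSpace.single i 1)) x (EuclideanSpace.single i 1) =
      fderiv ℝ (fun x' => γ (Ψ x') * fderiv ℝ Ψ x' x') x x +
        fderiv ℝ (fun x' => γ (Ψ x') * fderiv ℝ Ψ x' (J x')) x (J x) := by
  -- coordinates of `J`
  have hJ0 : ∀ y' : EuclideanSpace ℝ (Fin 2), J y' 0 = -(y' 1) := fun y' => by rw [hJ]; simp
  have hJ1 : ∀ y' : EuclideanSpace ℝ (Fin 2), J y' 1 = y' 0 := fun y' => by rw [hJ]; simp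
  -- regularity
  have hΨd : Differentiable ℝ Ψ := hΨ.differentiable two_ne_zero
  have hDΨ : ContDiff ℝ 1 (fderiv ℝ Ψ) := hΨ.fderiv_right (m := 1) le_rfl
  set u₀ : EuclideanSpace ℝ (Fin 2) → ℝ := fun x' => fderiv ℝ Ψ x' (EuclideanSpace.single 0 1) with hu₀_def
  set u₁ : EuclideanSpace ℝ (Fin 2) → ℝ := fun x' => fderiv ℝ Ψ x' (EuclideanSpace.single 1 1) with hu₁_def
  have hu₀d : Differentiable ℝ u₀ := (hDΨ.clm_apply contDiff_const).differentiable one_ne_zero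
  have hu₁d : Differentiable ℝ u₁ := (hDΨ.clm_apply contDiff_const).differentiable one_ne_zero
  have hγd : Differentiable ℝ γ := hγ.differentiable one_ne_zero
  have hγΨ : HasFDerivAt (fun x' => γ (Ψ x')) (deriv γ (Ψ x) • fderiv ℝ Ψ x) x :=
    (hγd (Ψ x)).hasDerivAt.comp_hasFDerivAt x (hΨd x).hasFDerivAt
  have hP0 := hasFDerivAt_coord_zero x
  have hP1 := hasFDerivAt_coord_one x
  -- the radial integrand, rewritten in coordinates, and its derivative along `x`
  have hFfun : (fun x' => γ (Ψ x') * fderiv ℝ Ψ x' x') = fun x' => γ (Ψ x') * (x' 0 * u₀ x' + x' 1 * u₁ x') := by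
    funext x'; rw [fderiv_apply_coord x' x']
  have hF : HasFDerivAt (fun x' => γ (Ψ x') * (x' 0 * u₀ x' + x' 1 * u₁ x'))
      (γ (Ψ x) • ((x 0) • fderiv ℝ u₀ x + u₀ x • EuclideanSpace.proj (0 : Fin 2) +
        ((x 1) • fderiv ℝ u₁ x + u₁ x • EuclideanSpace.proj (1 : Fin 2))) +
        (x 0 * u₀ x + x 1 * u₁ x) • (deriv γ (Ψ x) • fderiv ℝ Ψ x)) x :=
    hγΨ.mul ((hP0.mul (hu₀d x).hasFDerivAt).add (hP1.mul (hu₁d x).hasFDerivAt))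
  have hR1 : fderiv ℝ (fun x' => γ (Ψ x') * fderiv ℝ Ψ x' x') x x =
      γ (Ψ x) * (x 0 * (x 0 * fderiv ℝ u₀ x (EuclideanSpace.single 0 1) + x 1 * fderiv ℝ u₀ x (EuclideanSpace.single 1 1)) +
          u₀ x * x 0 +
        (x 1 * (x 0 * fderiv ℝ u₁ x (EuclideanSpace.single 0 1) + x 1 * fderiv ℝ u₁ x (EuclideanSpace.single 1 1)) +
          u₁ x * x 1)) +
        (x 0 * u₀ x + x 1 * u₁ x) * (deriv γ (Ψ x) * (x 0 * u₀ x + x 1 * u₁ x)) := by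
    rw [hFfun, hF.fderiv]
    simp only [add_apply, smul_apply, smul_eq_mul, proj_zero_apply, proj_one_apply]
    rw [fderiv_apply_coord (Ψ := u₀) x x, fderiv_apply_coord (Ψ := u₁) x x, fderiv_apply_coord (Ψ := Ψ) x x]
  -- the angular integrand, rewritten in coordinates, and its derivative along `J x`
  have hGfun : (fun x' => γ (Ψ x') * fderiv ℝ Ψ x' (J x')) = fun x' => γ (Ψ x') * (-(x' 1) * u₀ x' + x' 0 * u₁ x') := by
    funext x'; rw [fderiv_apply_coord x' (J x'), hJ0, hJ1]
  have hG : HasFDerivAt (fun x' => γ (Ψ x') * (-(x' 1) * u₀ x' + x' 0 * u₁ x'))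
      (γ (Ψ x) • ((-(x 1)) • fderiv ℝ u₀ x + u₀ x • (-EuclideanSpace.proj (1 : Fin 2)) +
        ((x 0) • fderiv ℝ u₁ x + u₁ x • EuclideanSpace.proj (0 : Fin 2))) +
        (-(x 1) * u₀ x + x 0 * u₁ x) • (deriv γ (Ψ x) • fderiv ℝ Ψ x)) x :=
    hγΨ.mul ((hP1.neg.mul (hu₀d x).hasFDerivAt).add (hP0.mul (hu₁d x).hasFDerivAt))
  have hR2 : fderiv ℝ (fun x' => γ (Ψ x') * fderiv ℝ Ψ x' (J x')) x (J x) =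
      γ (Ψ x) * (-(x 1) * (-(x 1) * fderiv ℝ u₀ x (EuclideanSpace.single 0 1) + x 0 * fderiv ℝ u₀ x (EuclideanSpace.single 1 1)) +
          u₀ x * (-(x 0)) +
        (x 0 * (-(x 1) * fderiv ℝ u₁ x (EuclideanSpace.single 0 1) + x 0 * fderiv ℝ u₁ x (EuclideanSpace.single 1 1)) +
          u₁ x * (-(x 1)))) +
        (-(x 1) * u₀ x + x 0 * u₁ x) * (deriv γ (Ψ x) * (-(x 1) * u₀ x + x 0 * u₁ x)) := by
    rw [hGfun, hG.fderiv]
    simp only [add_apply, smul_apply, neg_apply, smul_eq_mul, proj_zero_apply, proj_one_apply]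
    rw [fderiv_apply_coord (Ψ := u₀) x (J x), fderiv_apply_coord (Ψ := u₁) x (J x), fderiv_apply_coord (Ψ := Ψ) x (J x),
      hJ0, hJ1]
  -- the divergence side
  have hL : ∀ i : Fin 2, fderiv ℝ (fun x' => γ (Ψ x') * fderiv ℝ Ψ x' (EuclideanSpace.single i 1)) x (EuclideanSpace.single i 1) =
      γ (Ψ x) * fderiv ℝ (fun x' => fderiv ℝ Ψ x' (EuclideanSpace.single i 1)) x (EuclideanSpace.single i 1) +
        fderiv ℝ Ψ x (EuclideanSpace.single i 1) * (deriv γ (Ψ x) * fderiv ℝ Ψ x (EuclideanSpace.single i 1)) := by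
    intro i
    have hud : Differentiable ℝ fun x' => fderiv ℝ Ψ x' (EuclideanSpace.single i 1) :=
      (hDΨ.clm_apply contDiff_const).differentiable one_ne_zero
    have hmul : HasFDerivAt (fun x' => γ (Ψ x') * fderiv ℝ Ψ x' (EuclideanSpace.single i 1))
        (γ (Ψ x) • fderiv ℝ (fun x' => fderiv ℝ Ψ x' (EuclideanSpace.single i 1)) x +
          fderiv ℝ Ψ x (EuclideanSpace.single i 1) • (deriv γ (Ψ x) • fderiv ℝ Ψ x)) x :=
      hγΨ.mul (hud x).hasFDerivAt
    rw [hmul.fderiv]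
    simp only [add_apply, smul_apply, smul_eq_mul]
  -- `|x|² = x₀² + x₁²` (the tree's `Literature.Topology.FourManifolds.norm_sq_eq_add_sq`, inlined to keep the import closure small)
  have hnorm : ‖x‖ ^ 2 = x 0 ^ 2 + x 1 ^ 2 := by
    rw [EuclideanSpace.norm_eq, Real.sq_sqrt (Finset.sum_nonneg fun i _ => sq_nonneg _), Fin.sum_univ_two]
    simp [Real.norm_eq_abs, sq_abs]
  rw [Fin.sum_univ_two, hL 0, hL 1, hR1, hR2, hnorm]
  simp only [← hu₀_def, ← hu₁_def]
  ring

/-- **`Θ(|x|² ΘΨ) = |x|² ΘΘΨ`**: the squared radius is constant along rotation orbits (`D(|·|²)(x)[Jx] = 2⟪x, Jx⟫ = 0`). [folklore] -/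
theorem angularDeriv_normSq_mul (hΨ : ContDiff ℝ 2 Ψ)
    (hJ : ∀ y' : EuclideanSpace ℝ (Fin 2), J y' = (-(y' 1)) • EuclideanSpace.single (0 : Fin 2) (1 : ℝ) +
      (y' 0) • EuclideanSpace.single (1 : Fin 2) (1 : ℝ))
    (x : EuclideanSpace ℝ (Fin 2)) :
    fderiv ℝ (fun x' => ‖x'‖ ^ 2 * fderiv ℝ Ψ x' (J x')) x (J x) =
      ‖x‖ ^ 2 * fderiv ℝ (fun x' => fderiv ℝ Ψ x' (J x')) x (J x) := by
  have hJ0 : ∀ y' : EuclideanSpace ℝ (Fin 2), J y' 0 = -(y' 1) := fun y' => by rw [hJ]; simp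
  have hJ1 : ∀ y' : EuclideanSpace ℝ (Fin 2), J y' 1 = y' 0 := fun y' => by rw [hJ]; simp
  have hJ' : J = fun y' => (-(y' 1)) • EuclideanSpace.single (0 : Fin 2) (1 : ℝ) +
      (y' 0) • EuclideanSpace.single (1 : Fin 2) (1 : ℝ) := funext hJ
  have hJc : ContDiff ℝ 1 J := by rw [hJ']; fun_prop
  have hDΨ : ContDiff ℝ 1 (fderiv ℝ Ψ) := hΨ.fderiv_right (m := 1) le_rfl
  have hgd : Differentiable ℝ fun y' => fderiv ℝ Ψ y' (J y') := (hDΨ.clm_apply hJc).differentiable one_ne_zero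
  have hnfun : (fun x' : EuclideanSpace ℝ (Fin 2) => ‖x'‖ ^ 2) = fun x' => x' 0 * x' 0 + x' 1 * x' 1 := by
    funext x'
    rw [EuclideanSpace.norm_eq, Real.sq_sqrt (Finset.sum_nonneg fun i _ => sq_nonneg _), Fin.sum_univ_two]
    simp [Real.norm_eq_abs, sq]
  have hP0 := hasFDerivAt_coord_zero x
  have hP1 := hasFDerivAt_coord_one x
  have hn : HasFDerivAt (fun x' : EuclideanSpace ℝ (Fin 2) => ‖x'‖ ^ 2)
      (x 0 • (EuclideanSpace.proj (𝕜 := ℝ) (0 : Fin 2) : EuclideanSpace ℝ (Fin 2) →L[ℝ] ℝ) +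
        x 0 • (EuclideanSpace.proj (𝕜 := ℝ) (0 : Fin 2) : EuclideanSpace ℝ (Fin 2) →L[ℝ] ℝ) +
        (x 1 • (EuclideanSpace.proj (𝕜 := ℝ) (1 : Fin 2) : EuclideanSpace ℝ (Fin 2) →L[ℝ] ℝ) +
          x 1 • (EuclideanSpace.proj (𝕜 := ℝ) (1 : Fin 2) : EuclideanSpace ℝ (Fin 2) →L[ℝ] ℝ))) x := by
    rw [hnfun]
    exact (hP0.mul hP0).add (hP1.mul hP1)
  have hprod : HasFDerivAt (fun x' => ‖x'‖ ^ 2 * fderiv ℝ Ψ x' (J x'))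
      (‖x‖ ^ 2 • fderiv ℝ (fun x' => fderiv ℝ Ψ x' (J x')) x +
        fderiv ℝ Ψ x (J x) • (x 0 • (EuclideanSpace.proj (𝕜 := ℝ) (0 : Fin 2) : EuclideanSpace ℝ (Fin 2) →L[ℝ] ℝ) +
        x 0 • (EuclideanSpace.proj (𝕜 := ℝ) (0 : Fin 2) : EuclideanSpace ℝ (Fin 2) →L[ℝ] ℝ) +
        (x 1 • (EuclideanSpace.proj (𝕜 := ℝ) (1 : Fin 2) : EuclideanSpace ℝ (Fin 2) →L[ℝ] ℝ) +
          x 1 • (EuclideanSpace.proj (𝕜 := ℝ) (1 : Fin 2) : EuclideanSpace ℝ (Fin 2) →L[ℝ] ℝ)))) x :=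
    hn.mul (hgd x).hasFDerivAt
  rw [hprod.fderiv]
  simp only [add_apply, smul_apply, smul_eq_mul, proj_zero_apply, proj_one_apply, hJ0, hJ1]
  ring


/-- ★ **The profile equation in radius-as-time (log-polar) form.**  If the `C²` profile `Ψ` solves the rotating-pattern equation
`ω² ΘΘΨ = Σᵢ ∂ᵢ(γ(Ψ)∂ᵢΨ)` (`γ ∈ C¹`), then at every `x`
`X(γ(Ψ) XΨ)(x) = Θ((ω²|·|² − γ(Ψ)) ΘΨ)(x)`, i.e. `∂_ρ(γ(Ψ)Ψ_ρ) = ∂_θ((ω² e^{2ρ} − γ(Ψ)) Ψ_θ)` in the log-polar chart: the oblique-profile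
equation `∂₀(γ∂₀Ψ) = ∂₁((κ₀² − γ)∂₁Ψ)` of `…ZShockObliqueProfilePlane` with the drift `κ₀² = ω²e^{2ρ}` depending on the time-like variable —
hyperbolic with `ρ` as time exactly outside the sonic circle `ω²|x|² = γ(Ψ(x))`. [folklore] -/
theorem rotating_profile_equation_logpolar (hΨ : ContDiff ℝ 2 Ψ) (hγ : ContDiff ℝ 1 γ)
    (hJ : ∀ y' : EuclideanSpace ℝ (Fin 2), J y' = (-(y' 1)) • EuclideanSpace.single (0 : Fin 2) (1 : ℝ) +
      (y' 0) • EuclideanSpace.single (1 : Fin 2) (1 : ℝ))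
    (hrot : ∀ y : EuclideanSpace ℝ (Fin 2),
      ω ^ 2 * fderiv ℝ (fun y' => fderiv ℝ Ψ y' (J y')) y (J y) =
        ∑ i, fderiv ℝ (fun y' => γ (Ψ y') * fderiv ℝ Ψ y' (EuclideanSpace.single i 1)) y (EuclideanSpace.single i 1))
    (x : EuclideanSpace ℝ (Fin 2)) :
    fderiv ℝ (fun x' => γ (Ψ x') * fderiv ℝ Ψ x' x') x x =
      fderiv ℝ (fun x' => (ω ^ 2 * ‖x'‖ ^ 2 - γ (Ψ x')) * fderiv ℝ Ψ x' (J x')) x (J x) := by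
  have hJ' : J = fun y' => (-(y' 1)) • EuclideanSpace.single (0 : Fin 2) (1 : ℝ) +
      (y' 0) • EuclideanSpace.single (1 : Fin 2) (1 : ℝ) := funext hJ
  have hJc : ContDiff ℝ 1 J := by rw [hJ']; fun_prop
  have hΨd : Differentiable ℝ Ψ := hΨ.differentiable two_ne_zero
  have hDΨ : ContDiff ℝ 1 (fderiv ℝ Ψ) := hΨ.fderiv_right (m := 1) le_rfl
  have hgd : Differentiable ℝ fun y' => fderiv ℝ Ψ y' (J y') := (hDΨ.clm_apply hJc).differentiable one_ne_zero
  have hγΨd : Differentiable ℝ fun y' => γ (Ψ y') := (hγ.differentiable one_ne_zero).comp hΨd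
  have hnd : Differentiable ℝ fun x' : EuclideanSpace ℝ (Fin 2) => ‖x'‖ ^ 2 := (contDiff_norm_sq ℝ (n := 1)).differentiable one_ne_zero
  -- split the right-hand side
  have hfun : (fun x' => (ω ^ 2 * ‖x'‖ ^ 2 - γ (Ψ x')) * fderiv ℝ Ψ x' (J x')) =
      fun x' => ω ^ 2 * (‖x'‖ ^ 2 * fderiv ℝ Ψ x' (J x')) - γ (Ψ x') * fderiv ℝ Ψ x' (J x') := by
    funext x'; ring
  have hA : HasFDerivAt (fun x' => ‖x'‖ ^ 2 * fderiv ℝ Ψ x' (J x'))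
      (fderiv ℝ (fun x' => ‖x'‖ ^ 2 * fderiv ℝ Ψ x' (J x')) x) x := ((hnd.mul hgd) x).hasFDerivAt
  have hB : HasFDerivAt (fun x' => γ (Ψ x') * fderiv ℝ Ψ x' (J x'))
      (fderiv ℝ (fun x' => γ (Ψ x') * fderiv ℝ Ψ x' (J x')) x) x := ((hγΨd.mul hgd) x).hasFDerivAt
  have hC : HasFDerivAt (fun x' => ω ^ 2 * (‖x'‖ ^ 2 * fderiv ℝ Ψ x' (J x')) - γ (Ψ x') * fderiv ℝ Ψ x' (J x'))
      (ω ^ 2 • fderiv ℝ (fun x' => ‖x'‖ ^ 2 * fderiv ℝ Ψ x' (J x')) x -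
        fderiv ℝ (fun x' => γ (Ψ x') * fderiv ℝ Ψ x' (J x')) x) x :=
    (hA.const_mul (ω ^ 2)).sub hB
  rw [hfun, hC.fderiv, sub_apply, smul_apply, smul_eq_mul, angularDeriv_normSq_mul hΨ hJ x]
  have h1 := normSq_mul_divForm_eq hΨ hγ hJ x
  rw [← hrot x] at h1
  linarith

/-! ### The radial dichotomy -/

/-- ★ **The radial dichotomy.**  If the `C²` profile `Ψ` solves the rotating-pattern equation `ω² ΘΘΨ = Σᵢ ∂ᵢ(γ(Ψ)∂ᵢΨ)` and does
not turn at all, `ΘΨ ≡ 0` (for an arbitrary field `J`), then `Σᵢ ∂ᵢ(γ(Ψ)∂ᵢΨ) = 0`, and if moreover `Ψ` is bounded and `0 < γlo ≤ γ ≤ γhi`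
(`γ ∈ C¹`) then `Ψ` is CONSTANT — the tree's `obliqueProfile_const_of_subsonic_plane` at drift speed `0` (Moser's Liouville theorem
`Literature.Analysis.PDE.DivForm.divFormLiouville_holds`).  So a non-constant rotating inhabitant of the autonomous column has `ΘΨ ≢ 0`.
[folklore] -/
theorem rotating_radial_const (hΨ : ContDiff ℝ 2 Ψ) (hγ : ContDiff ℝ 1 γ)
    (hrot : ∀ y : EuclideanSpace ℝ (Fin 2),
      ω ^ 2 * fderiv ℝ (fun y' => fderiv ℝ Ψ y' (J y')) y (J y) =
        ∑ i, fderiv ℝ (fun y' => γ (Ψ y') * fderiv ℝ Ψ y' (EuclideanSpace.single i 1)) y (EuclideanSpace.single i 1))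
    (hradial : ∀ y : EuclideanSpace ℝ (Fin 2), fderiv ℝ Ψ y (J y) = 0)
    {γlo γhi MΨ : ℝ} (hγlo0 : 0 < γlo) (hγlo : ∀ r, γlo ≤ γ r) (hγhi : ∀ r, γ r ≤ γhi) (hMΨ : ∀ y, |Ψ y| ≤ MΨ) :
    ∀ y y' : EuclideanSpace ℝ (Fin 2), Ψ y = Ψ y' := by
  have hΘ0 : (fun y' => fderiv ℝ Ψ y' (J y')) = fun _ => (0 : ℝ) := funext hradial
  have hdiv : ∀ y : EuclideanSpace ℝ (Fin 2),
      ∑ i, fderiv ℝ (fun y' => γ (Ψ y') * fderiv ℝ Ψ y' (EuclideanSpace.single i 1)) y (EuclideanSpace.single i 1) = 0 := by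
    intro y
    rw [← hrot y, hΘ0]
    simp
  refine obliqueProfile_const_of_subsonic_plane (κ₀ := 0) hΨ hγ (fun y => ?_) (by simpa using hγlo0) hγlo hγhi hMΨ
  have h := hdiv y
  rw [Fin.sum_univ_two] at h
  have hf : (fun y' => ((0 : ℝ) ^ 2 - γ (Ψ y')) * fderiv ℝ Ψ y' (EuclideanSpace.single 1 1)) =
      fun y' => -(γ (Ψ y') * fderiv ℝ Ψ y' (EuclideanSpace.single 1 1)) := by
    funext y'; ring
  rw [hf, fderiv_fun_neg, neg_apply]
  linarith

end Summit.NavierStokesRegularity.NavierStokesRegularity.Theorems.PoloidalWindowDoorPoloidalWindowRigidityZShockRotatingProfileLogPolar
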